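import Literature.NumberTheory.Automorphic.GKCohomology
import Literature.NumberTheory.Automorphic.AdelicGLnGlue
import Literature.NumberTheory.Automorphic.AdelicAdditiveCharacterDuality
import Literature.Algebra.Lie.ChevalleyEilenbergCentralBasic
import Mathlib.Analysis.InnerProductSpace.PiL2
import Mathlib.LinearAlgebra.BilinearForm.Properties
import Mathlib.Algebra.Lie.InvariantForm
import HarnessLib

/-!
# Cartan data for `𝔤 = 𝔤𝔩ₙ(K_∞)`: the real trace form, `𝔤 = 𝔨 ⊕ ℝ·1 ⊕ 𝔭₀`, and adapted bases

Topic `NumberTheory/Automorphic`; namespace `Literature.NumberTheory.Automorphic.ResGLnCartan`.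
Definitions with bodies and theorems; no named fact, no `sorry`.

For the archimedean group `G_∞ = GL_n(K_∞)` of `Res_{K/ℚ} GL_n` (`archGroupGL n K`,
`K_∞ = mixedSpace K = ℝ^{r₁} × ℂ^{r₂}` a real `*`-algebra) and its real Lie algebra
`𝔤 = (archGroupGL n K).lie = M_n(K_∞)`:

* `trForm n K` — the REAL TRACE FORM `B(X, Y) = Tr_{K_∞/ℝ} tr(XY)` (`mixedTrace`), a symmetric
  (`trForm_isSymm`), `ad`-invariant (`trForm_lieInvariant`) and non-degenerate
  (`trForm_nondegenerate`) real bilinear form on `𝔤`; `trForm_star_star`, and POSITIVITY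
  `B(X, X⋆) ≥ 0` with equality iff `X = 0` (`trForm_self_star_nonneg`, `eq_zero_of_trForm_self_star`);
* the Cartan decomposition: `𝔨 = {X⋆ = -X}` is the tree's `kInLie`, `herm = {X⋆ = X}`,
  `B(𝔨, herm) = 0` (`trForm_skew_herm`), `B > 0` on `herm ∖ 0`, `X = (X - X⋆)/2 + (X + X⋆)/2`;
  the centre direction `one = 1 ∈ 𝔤` (central: `lie_one`), `𝔭₀ = {X ∈ herm | B(X, 1) = 0}` and
  `K' = 𝔨 + ℝ·1 = centralSup kInLie one` (`ChevalleyEilenbergCentralBasic`):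
  `herm = ℝ·1 ⊕ 𝔭₀`, `𝔤 = K' ⊕ 𝔭₀` (`isCompl_kPrime_pZero`), `⁅𝔭₀, 𝔭₀⁆ ⊆ 𝔨 ⊆ K'`
  (`lie_mem_kPrime_of_mem_pZero`), `B(𝔭₀, K') = 0` (`trForm_pZero_kPrime`);
* ADAPTED BASES in the format of Kuga's lemma (`ChevalleyEilenbergKugaAdjoint`,
  `d_eq_zero_of_casimirOp_eq_zero`): a `B`-ORTHONORMAL basis `xONB` of `𝔭₀`
  (`trForm_xONB`: Gram–Schmidt for the positive definite `B|𝔭₀`), a basis `adaptedBasis` of `𝔤`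
  indexed by `ι ⊕ κ` with `adaptedBasis ∘ inl = xONB`, and its `B`-dual basis:
  `dualBasis ∘ inl = xONB` (`dualBasis_adaptedBasis_inl`) and `dualBasis ∘ inr ∈ K'`
  (`dualBasis_adaptedBasis_inr_mem`); whence the hypotheses `hspan`, `hxx`, `hw'` and — by
  `Literature.Algebra.Lie.sum_lie_basis_tmul_dualBasis_add` — the invariant tensor identity `hT`
  (`kuga_hspan`, `kuga_hxx`, `kuga_hw'`, `kuga_hT`).

Input (G1) of Step 2 of Borel's injectivity of cuspidal cohomology in the cone model
(`ResGLnCuspidalCohomologyApex`). [cite: BorelWallach2000, II §2.1–2.5, §3.1]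

## References

* A. Borel, N. Wallach, *Continuous cohomology, discrete subgroups, and representations of reductive
  groups*, 2nd ed. (2000), II §2.1–2.5, §3.1 (held). [BorelWallach2000]
* A. W. Knapp, *Lie Groups Beyond an Introduction*, 2nd ed. (2002), §I.8, §V.4, §VI.2. [Knapp2002]
-/

noncomputable section

-- Mathlib idiom (as in `GKModules`): commutator bracket on matrix algebras
attribute [local instance 100] LieRing.ofAssociativeRing

-- `Classical`: the place subtypes indexing `mixedSpace K` are `Fintype` classically (as in `AdelicGLnGlue`).
open scoped Matrix TensorProduct Classical
open Finset _root_.NumberField _root_.NumberField.InfinitePlace _root_.NumberField.mixedEmbedding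

namespace Literature.NumberTheory.Automorphic

namespace ResGLnCartan

variable (n : ℕ) (K : Type) [Field K] [NumberField K]

/-- Shorthand: the real Lie algebra `𝔤 = M_n(K_∞)` of `G_∞` (all matrices, `archGroupGL_lie`). [folklore] -/
abbrev 𝔤 : LieSubalgebra ℝ (Matrix (Fin n) (Fin n) (mixedSpace K)) := (archGroupGL n K).lie

variable {n K}

/-- Every matrix lies in `𝔤`. [folklore] -/
theorem mem_𝔤 (X : Matrix (Fin n) (Fin n) (mixedSpace K)) : X ∈ 𝔤 n K := by
  simp only [𝔤, archGroupGL_lie, LieSubalgebra.mem_top]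

/-- The element of `𝔤` with a given matrix. [folklore] -/
def ofMatrix (X : Matrix (Fin n) (Fin n) (mixedSpace K)) : 𝔤 n K := ⟨X, mem_𝔤 X⟩

/-- Its matrix. [folklore] -/
@[simp] theorem coe_ofMatrix (X : Matrix (Fin n) (Fin n) (mixedSpace K)) :
    ((ofMatrix X : 𝔤 n K) : Matrix (Fin n) (Fin n) (mixedSpace K)) = X := rfl

/-- Coercion of a sum. [folklore] -/
@[simp] theorem coe_add' (X Y : 𝔤 n K) :
    ((X + Y : 𝔤 n K) : Matrix (Fin n) (Fin n) (mixedSpace K)) = (X : Matrix (Fin n) (Fin n) (mixedSpace K)) + Y := rfl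

/-- Coercion of a scalar multiple. [folklore] -/
@[simp] theorem coe_smul' (c : ℝ) (X : 𝔤 n K) :
    ((c • X : 𝔤 n K) : Matrix (Fin n) (Fin n) (mixedSpace K)) = c • (X : Matrix (Fin n) (Fin n) (mixedSpace K)) := rfl

/-- Coercion of a negative. [folklore] -/
@[simp] theorem coe_neg' (X : 𝔤 n K) :
    ((-X : 𝔤 n K) : Matrix (Fin n) (Fin n) (mixedSpace K)) = -(X : Matrix (Fin n) (Fin n) (mixedSpace K)) := rfl

/-- Coercion of a difference. [folklore] -/
@[simp] theorem coe_sub' (X Y : 𝔤 n K) :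
    ((X - Y : 𝔤 n K) : Matrix (Fin n) (Fin n) (mixedSpace K)) = (X : Matrix (Fin n) (Fin n) (mixedSpace K)) - Y := rfl

/-! ### The involution `X ↦ X⋆` on `𝔤` -/

/-- `X⋆ = Xᴴ` as an `ℝ`-linear map of `𝔤`. [folklore] -/
def starL : 𝔤 n K →ₗ[ℝ] 𝔤 n K where
  toFun X := ofMatrix (X : Matrix (Fin n) (Fin n) (mixedSpace K))ᴴ
  map_add' X Y := Subtype.ext (by
    change ((X : Matrix (Fin n) (Fin n) (mixedSpace K)) + (Y : Matrix (Fin n) (Fin n) (mixedSpace K)))ᴴ =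
      (X : Matrix (Fin n) (Fin n) (mixedSpace K))ᴴ + (Y : Matrix (Fin n) (Fin n) (mixedSpace K))ᴴ
    exact Matrix.conjTranspose_add _ _)
  map_smul' c X := Subtype.ext (by
    change ((c • (X : Matrix (Fin n) (Fin n) (mixedSpace K)))ᴴ) = c • (X : Matrix (Fin n) (Fin n) (mixedSpace K))ᴴ
    rw [Matrix.conjTranspose_smul, star_trivial])

/-- The matrix of `X⋆`. [folklore] -/
@[simp] theorem coe_starL (X : 𝔤 n K) :
    ((starL X : 𝔤 n K) : Matrix (Fin n) (Fin n) (mixedSpace K)) = (X : Matrix (Fin n) (Fin n) (mixedSpace K))ᴴ := rfl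

/-- `X⋆⋆ = X`. [folklore] -/
theorem starL_starL (X : 𝔤 n K) : starL (starL X) = X :=
  Subtype.ext (Matrix.conjTranspose_conjTranspose _)

/-! ### The real trace form -/

variable (n K) in
/-- **The real trace form** `B(X, Y) = Tr_{K_∞/ℝ} (tr (X Y))` on `𝔤 = M_n(K_∞)`.
[cite: Knapp2002, §I.8] -/
def trForm : LinearMap.BilinForm ℝ (𝔤 n K) :=
  LinearMap.mk₂ ℝ (fun X Y => mixedTrace K (((X : Matrix (Fin n) (Fin n) (mixedSpace K)) * Y).trace))
    (fun X X' Y => by rw [coe_add', Matrix.add_mul, Matrix.trace_add, map_add])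
    (fun c X Y => by rw [coe_smul', Matrix.smul_mul, Matrix.trace_smul, map_smul, smul_eq_mul])
    (fun X Y Y' => by rw [coe_add', Matrix.mul_add, Matrix.trace_add, map_add])
    (fun c X Y => by rw [coe_smul', Matrix.mul_smul, Matrix.trace_smul, map_smul, smul_eq_mul])

/-- Unfolding. [folklore] -/
theorem trForm_apply (X Y : 𝔤 n K) :
    trForm n K X Y = mixedTrace K (((X : Matrix (Fin n) (Fin n) (mixedSpace K)) * Y).trace) := rfl

/-- `B` is symmetric. [folklore] -/
theorem trForm_isSymm : (trForm n K).IsSymm :=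
  ⟨fun X Y => by rw [trForm_apply, trForm_apply, Matrix.trace_mul_comm]⟩

/-- `B` is symmetric (pointwise). [folklore] -/
theorem trForm_comm (X Y : 𝔤 n K) : trForm n K X Y = trForm n K Y X :=
  trForm_isSymm.eq X Y

/-- `Tr tr ((AB - BA) C) = -Tr tr (B (AC - CA))` (invariance of the trace form, on matrices).
[cite: Knapp2002, §I.8] -/
theorem mixedTrace_trace_comm_mul (A B C : Matrix (Fin n) (Fin n) (mixedSpace K)) :
    mixedTrace K ((A * B - B * A) * C).trace = -mixedTrace K (B * (A * C - C * A)).trace := by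
  simp only [Matrix.sub_mul, Matrix.mul_sub, Matrix.trace_sub, map_sub, Matrix.mul_assoc]
  rw [Matrix.trace_mul_comm B (C * A), Matrix.mul_assoc, Matrix.trace_mul_comm C (A * B), Matrix.mul_assoc]
  ring

/-- **`B` is `ad`-invariant**: `B([X, Y], Z) = -B(Y, [X, Z])`. [cite: Knapp2002, §I.8] -/
theorem trForm_lieInvariant : (trForm n K).lieInvariant (𝔤 n K) := by
  intro X Y Z
  rw [trForm_apply, trForm_apply, LieSubalgebra.coe_bracket, LieSubalgebra.coe_bracket, Ring.lie_def, Ring.lie_def]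
  exact mixedTrace_trace_comm_mul _ _ _

/-- `Tr_{K_∞/ℝ}` is real: `Tr (a⋆) = Tr a`. [folklore] -/
theorem mixedTrace_star (a : mixedSpace K) : mixedTrace K (star a) = mixedTrace K a := by
  rw [mixedTrace_apply, mixedTrace_apply]
  simp only [Prod.fst_star, Prod.snd_star, Pi.star_apply, star_trivial, Complex.star_def, Complex.conj_re]

/-- `B(X⋆, Y⋆) = B(X, Y)`. [folklore] -/
theorem trForm_star_star (X Y : 𝔤 n K) : trForm n K (starL X) (starL Y) = trForm n K X Y := by
  rw [trForm_apply, trForm_comm, trForm_apply, coe_starL, coe_starL, ← Matrix.conjTranspose_mul,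
    Matrix.trace_conjTranspose, mixedTrace_star]

/-- `Tr_{K_∞/ℝ} (a a⋆) = Σ_{w real} a_w² + Σ_{w complex} 2 |a_w|²`. [folklore] -/
theorem mixedTrace_mul_star_self (a : mixedSpace K) :
    mixedTrace K (a * star a) =
      (∑ w : {w : InfinitePlace K // w.IsReal}, a.1 w ^ 2) +
        ∑ w : {w : InfinitePlace K // w.IsComplex}, 2 * Complex.normSq (a.2 w) := by
  rw [mixedTrace_apply]
  congr 1
  · exact sum_congr rfl fun w _ => by rw [Prod.fst_mul, Pi.mul_apply, Prod.fst_star, Pi.star_apply, star_trivial, sq]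
  · exact sum_congr rfl fun w _ => by
      rw [Prod.snd_mul, Pi.mul_apply, Prod.snd_star, Pi.star_apply, Complex.star_def, Complex.mul_conj,
        Complex.ofReal_re]

/-- `Tr_{K_∞/ℝ} (a a⋆) ≥ 0`. [folklore] -/
theorem mixedTrace_mul_star_self_nonneg (a : mixedSpace K) : 0 ≤ mixedTrace K (a * star a) := by
  rw [mixedTrace_mul_star_self]
  exact add_nonneg (sum_nonneg fun w _ => sq_nonneg _)
    (sum_nonneg fun w _ => mul_nonneg zero_le_two (Complex.normSq_nonneg _))

/-- `Tr_{K_∞/ℝ} (a a⋆) = 0 ⇒ a = 0`. [folklore] -/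
theorem eq_zero_of_mixedTrace_mul_star_self (a : mixedSpace K) (h : mixedTrace K (a * star a) = 0) : a = 0 := by
  rw [mixedTrace_mul_star_self] at h
  have hA : 0 ≤ ∑ w : {w : InfinitePlace K // w.IsReal}, a.1 w ^ 2 := sum_nonneg fun w _ => sq_nonneg _
  have hB : 0 ≤ ∑ w : {w : InfinitePlace K // w.IsComplex}, 2 * Complex.normSq (a.2 w) :=
    sum_nonneg fun w _ => mul_nonneg zero_le_two (Complex.normSq_nonneg _)
  have hA0 : ∑ w : {w : InfinitePlace K // w.IsReal}, a.1 w ^ 2 = 0 := le_antisymm (by linarith) hA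
  have hB0 : ∑ w : {w : InfinitePlace K // w.IsComplex}, 2 * Complex.normSq (a.2 w) = 0 := le_antisymm (by linarith) hB
  refine Prod.ext (funext fun w => ?_) (funext fun w => ?_)
  · have h1 := (sum_eq_zero_iff_of_nonneg (fun w _ => sq_nonneg (a.1 w))).1 hA0 w (mem_univ w)
    simpa using h1
  · have h1 := (sum_eq_zero_iff_of_nonneg (fun w _ => mul_nonneg zero_le_two (Complex.normSq_nonneg (a.2 w)))).1
      hB0 w (mem_univ w)
    have h2 : Complex.normSq (a.2 w) = 0 := (mul_eq_zero.1 h1).resolve_left two_ne_zero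
    simpa using Complex.normSq_eq_zero.1 h2

/-- `B(X, X⋆) = Σ_{ij} Tr_{K_∞/ℝ} (x_{ij} x_{ij}⋆)`. [folklore] -/
theorem trForm_self_star_eq_sum (X : 𝔤 n K) :
    trForm n K X (starL X) =
      ∑ i, ∑ j, mixedTrace K ((X : Matrix (Fin n) (Fin n) (mixedSpace K)) i j *
        star ((X : Matrix (Fin n) (Fin n) (mixedSpace K)) i j)) := by
  rw [trForm_apply, coe_starL, Matrix.trace]
  simp only [Matrix.diag_apply, Matrix.mul_apply, Matrix.conjTranspose_apply, map_sum]

/-- **Positivity**: `B(X, X⋆) ≥ 0`. [cite: Knapp2002, §VI.2] -/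
theorem trForm_self_star_nonneg (X : 𝔤 n K) : 0 ≤ trForm n K X (starL X) := by
  rw [trForm_self_star_eq_sum]
  exact sum_nonneg fun i _ => sum_nonneg fun j _ => mixedTrace_mul_star_self_nonneg _

/-- **Definiteness**: `B(X, X⋆) = 0 ⇒ X = 0`. [cite: Knapp2002, §VI.2] -/
theorem eq_zero_of_trForm_self_star (X : 𝔤 n K) (h : trForm n K X (starL X) = 0) : X = 0 := by
  rw [trForm_self_star_eq_sum] at h
  have h1 := (sum_eq_zero_iff_of_nonneg (fun i _ => sum_nonneg fun j _ => mixedTrace_mul_star_self_nonneg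
    ((X : Matrix (Fin n) (Fin n) (mixedSpace K)) i j))).1 h
  refine Subtype.ext (Matrix.ext fun i j => ?_)
  have h2 := (sum_eq_zero_iff_of_nonneg (fun j _ => mixedTrace_mul_star_self_nonneg
    ((X : Matrix (Fin n) (Fin n) (mixedSpace K)) i j))).1 (h1 i (mem_univ i)) j (mem_univ j)
  rw [eq_zero_of_mixedTrace_mul_star_self _ h2]
  rfl

/-- **`B` is non-degenerate** (test against `X⋆`). [cite: Knapp2002, §I.8] -/
theorem trForm_nondegenerate : (trForm n K).Nondegenerate :=
  ⟨fun X hX => eq_zero_of_trForm_self_star X (hX _),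
    fun Y hY => eq_zero_of_trForm_self_star Y (by rw [trForm_comm]; exact hY _)⟩

/-! ### The Cartan decomposition `𝔤 = 𝔨 ⊕ herm`, `herm = ℝ·1 ⊕ 𝔭₀` -/

/-- Membership in `𝔨 = kInLie`: `X⋆ = -X`. [folklore] -/
theorem mem_kInLie_iff_star (X : 𝔤 n K) : X ∈ (archGroupGL n K).kInLie ↔ starL X = -X := by
  rw [RealMatrixGroup.mem_kInLie_iff, RealMatrixGroup.mem_compactLie_iff, Matrix.star_eq_conjTranspose]
  constructor
  · rintro ⟨-, h⟩
    exact Subtype.ext h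
  · intro h
    exact ⟨X.2, congrArg Subtype.val h⟩

/-- `B(S, P) = 0` for `S⋆ = -S`, `P⋆ = P`. [cite: Knapp2002, §VI.2] -/
theorem trForm_skew_herm {S P : 𝔤 n K} (hS : starL S = -S) (hP : starL P = P) : trForm n K S P = 0 := by
  have h := trForm_star_star S P
  rw [hS, hP, map_neg, LinearMap.neg_apply] at h
  linarith

/-- `B(P, P) > 0` for `P⋆ = P`, `P ≠ 0`; stated as `B(P, P) = 0 ⇒ P = 0`. [cite: Knapp2002, §VI.2] -/
theorem eq_zero_of_herm_of_trForm_self {P : 𝔤 n K} (hP : starL P = P) (h : trForm n K P P = 0) : P = 0 :=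
  eq_zero_of_trForm_self_star P (by rw [hP]; exact h)

/-- `B(P, P) ≥ 0` for `P⋆ = P`. [cite: Knapp2002, §VI.2] -/
theorem trForm_self_nonneg_of_herm {P : 𝔤 n K} (hP : starL P = P) : 0 ≤ trForm n K P P := by
  have h := trForm_self_star_nonneg P
  rwa [hP] at h

/-- The centre direction `1 ∈ 𝔤`. [folklore] -/
def one : 𝔤 n K := ofMatrix 1

/-- `1` is central. [folklore] -/
theorem lie_one (X : 𝔤 n K) : ⁅(one : 𝔤 n K), X⁆ = 0 :=
  Subtype.ext (by rw [LieSubalgebra.coe_bracket, Ring.lie_def]; simp [one])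

/-- `1⋆ = 1`. [folklore] -/
theorem starL_one : starL (one : 𝔤 n K) = one :=
  Subtype.ext (by
    change ((1 : Matrix (Fin n) (Fin n) (mixedSpace K)))ᴴ = 1
    exact Matrix.conjTranspose_one)

/-- **`𝔭₀`**: Hermitian matrices `B`-orthogonal to `1` (trace-zero for `Tr_{K_∞/ℝ} ∘ tr`).
[cite: BorelWallach2000, II §3.1] -/
def pZero : Submodule ℝ (𝔤 n K) where
  carrier := {P | starL P = P ∧ trForm n K P one = 0}
  add_mem' := by
    rintro P Q ⟨hP, hP1⟩ ⟨hQ, hQ1⟩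
    exact ⟨by rw [map_add, hP, hQ], by rw [map_add, LinearMap.add_apply, hP1, hQ1, add_zero]⟩
  zero_mem' := ⟨map_zero _, by rw [map_zero, LinearMap.zero_apply]⟩
  smul_mem' := by
    rintro c P ⟨hP, hP1⟩
    exact ⟨by rw [map_smul, hP], by rw [map_smul, LinearMap.smul_apply, hP1, smul_zero]⟩

/-- Membership in `𝔭₀`. [folklore] -/
theorem mem_pZero_iff (P : 𝔤 n K) : P ∈ (pZero : Submodule ℝ (𝔤 n K)) ↔ starL P = P ∧ trForm n K P one = 0 :=
  Iff.rfl

/-- **`K' = 𝔨 + ℝ·1`** as a Lie subalgebra (`centralSup`, `1` central). [cite: BorelWallach2000, I §1.3] -/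
def kPrime : LieSubalgebra ℝ (𝔤 n K) :=
  Literature.Algebra.Lie.ChevalleyEilenberg.centralSup (archGroupGL n K).kInLie one lie_one

/-- Membership in `K'`: `Y = S + c • 1` with `S⋆ = -S`. [folklore] -/
theorem mem_kPrime_iff (Y : 𝔤 n K) :
    Y ∈ (kPrime : LieSubalgebra ℝ (𝔤 n K)) ↔ ∃ S : 𝔤 n K, starL S = -S ∧ ∃ c : ℝ, Y = S + c • one := by
  rw [kPrime, Literature.Algebra.Lie.ChevalleyEilenberg.mem_centralSup_iff]
  constructor
  · rintro ⟨S, hS, c, rfl⟩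
    exact ⟨S, (mem_kInLie_iff_star S).1 hS, c, rfl⟩
  · rintro ⟨S, hS, c, rfl⟩
    exact ⟨S, (mem_kInLie_iff_star S).2 hS, c, rfl⟩

/-- `𝔨 ≤ K'`. [folklore] -/
theorem kInLie_le_kPrime : (archGroupGL n K).kInLie ≤ (kPrime : LieSubalgebra ℝ (𝔤 n K)) :=
  Literature.Algebra.Lie.ChevalleyEilenberg.le_centralSup _ _ _

/-- **`B(𝔭₀, K') = 0`**. [cite: Knapp2002, §VI.2] -/
theorem trForm_pZero_kPrime {P Y : 𝔤 n K} (hP : P ∈ (pZero : Submodule ℝ (𝔤 n K)))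
    (hY : Y ∈ (kPrime : LieSubalgebra ℝ (𝔤 n K))) : trForm n K P Y = 0 := by
  obtain ⟨S, hS, c, rfl⟩ := (mem_kPrime_iff Y).1 hY
  rw [map_add, map_smul, trForm_comm P S, trForm_skew_herm hS hP.1, hP.2, smul_zero, add_zero]

/-- **`⁅𝔭₀, 𝔭₀⁆ ⊆ 𝔨 ⊆ K'`**: the commutator of Hermitian matrices is skew-Hermitian.
[cite: Knapp2002, §VI.2] -/
theorem lie_mem_kPrime_of_herm {P Q : 𝔤 n K} (hP : starL P = P) (hQ : starL Q = Q) :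
    ⁅P, Q⁆ ∈ (kPrime : LieSubalgebra ℝ (𝔤 n K)) := by
  refine kInLie_le_kPrime ((mem_kInLie_iff_star _).2 (Subtype.ext ?_))
  have hP' : (P : Matrix (Fin n) (Fin n) (mixedSpace K))ᴴ = P := congrArg Subtype.val hP
  have hQ' : (Q : Matrix (Fin n) (Fin n) (mixedSpace K))ᴴ = Q := congrArg Subtype.val hQ
  rw [coe_starL, LieSubalgebra.coe_bracket, Ring.lie_def, Matrix.conjTranspose_sub, Matrix.conjTranspose_mul,
    Matrix.conjTranspose_mul, hP', hQ', coe_neg', LieSubalgebra.coe_bracket, Ring.lie_def, neg_sub]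

/-- The `K'`-component of `X`: `(X - X⋆)/2 + (B(X, 1)/B(1, 1)) • 1`. [folklore] -/
def kPart (X : 𝔤 n K) : 𝔤 n K :=
  (1 / 2 : ℝ) • (X - starL X) + (trForm n K X one * (trForm n K one one)⁻¹) • one

/-- The `𝔭₀`-component of `X`: `(X + X⋆)/2 - (B(X, 1)/B(1, 1)) • 1`. [folklore] -/
def pPart (X : 𝔤 n K) : 𝔤 n K :=
  (1 / 2 : ℝ) • (X + starL X) - (trForm n K X one * (trForm n K one one)⁻¹) • one

/-- `X = kPart X + pPart X`. [folklore] -/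
theorem kPart_add_pPart (X : 𝔤 n K) : kPart X + pPart X = X := by
  simp only [kPart, pPart]
  module

/-- `kPart X ∈ K'`. [folklore] -/
theorem kPart_mem (X : 𝔤 n K) : kPart X ∈ (kPrime : LieSubalgebra ℝ (𝔤 n K)) := by
  refine (mem_kPrime_iff _).2 ⟨(1 / 2 : ℝ) • (X - starL X), ?_, _, rfl⟩
  rw [map_smul, map_sub, starL_starL, ← smul_neg, neg_sub]

/-- `B(X⋆, 1) = B(X, 1)`. [folklore] -/
theorem trForm_starL_one (X : 𝔤 n K) : trForm n K (starL X) one = trForm n K X one := by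
  conv_rhs => rw [← trForm_star_star X one, starL_one]

/-- If `B(1, 1) = 0` then `n = 0`, so `𝔤 = 0`. [folklore] -/
theorem subsingleton_of_trForm_one_one (h : trForm n K (one : 𝔤 n K) one = 0) : Subsingleton (𝔤 n K) := by
  have h1 : (one : 𝔤 n K) = 0 := eq_zero_of_herm_of_trForm_self starL_one h
  have hn : n = 0 := by
    by_contra hn
    have : ((one : 𝔤 n K) : Matrix (Fin n) (Fin n) (mixedSpace K)) ⟨0, Nat.pos_of_ne_zero hn⟩ ⟨0, Nat.pos_of_ne_zero hn⟩ = 0 := by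
      rw [h1]; rfl
    simp [one] at this
  subst hn
  exact ⟨fun a b => Subtype.ext (Matrix.ext fun i => Fin.elim0 i)⟩

/-- `pPart X ∈ 𝔭₀`. [folklore] -/
theorem pPart_mem (X : 𝔤 n K) : pPart X ∈ (pZero : Submodule ℝ (𝔤 n K)) := by
  refine ⟨?_, ?_⟩
  · simp only [pPart, map_sub, map_smul, map_add, starL_starL, starL_one, add_comm]
  · rw [pPart, map_sub, LinearMap.sub_apply, map_smul, LinearMap.smul_apply, map_add, LinearMap.add_apply,
      trForm_starL_one, map_smul, LinearMap.smul_apply, smul_eq_mul, smul_eq_mul]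
    by_cases h : trForm n K (one : 𝔤 n K) one = 0
    · haveI := subsingleton_of_trForm_one_one h
      rw [Subsingleton.elim X 0, map_zero, LinearMap.zero_apply]
      ring
    · field_simp
      ring

/-- **`𝔤 = K' ⊕ 𝔭₀`** (as real vector spaces). [cite: Knapp2002, §VI.2] -/
theorem isCompl_kPrime_pZero :
    IsCompl ((kPrime : LieSubalgebra ℝ (𝔤 n K)).toSubmodule) (pZero : Submodule ℝ (𝔤 n K)) := by
  refine IsCompl.of_eq ?_ ?_
  · rw [Submodule.eq_bot_iff]
    rintro X ⟨hXk, hXp⟩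
    have hXk' : X ∈ (kPrime : LieSubalgebra ℝ (𝔤 n K)) := hXk
    have h0 : trForm n K X X = 0 := trForm_pZero_kPrime hXp hXk'
    exact eq_zero_of_herm_of_trForm_self hXp.1 h0
  · rw [Submodule.eq_top_iff']
    intro X
    rw [← kPart_add_pPart X]
    exact Submodule.add_mem_sup (kPart_mem X) (pPart_mem X)


/-! ### Adapted bases: a `B`-orthonormal basis of `𝔭₀`, a basis of `K'`, and the dual basis -/

section Bases

variable (n K)

/-- `𝔤` is finite-dimensional over `ℝ`. [folklore] -/
instance finiteDimensional_𝔤 : FiniteDimensional ℝ (𝔤 n K) :=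
  inferInstanceAs (FiniteDimensional ℝ ↥((𝔤 n K).toSubmodule))

/-- `dim_ℝ 𝔭₀`. [folklore] -/
def pZeroDim : ℕ := Module.finrank ℝ (pZero : Submodule ℝ (𝔤 n K))

/-- `dim_ℝ K'`. [folklore] -/
def kDim : ℕ := Module.finrank ℝ ((kPrime : LieSubalgebra ℝ (𝔤 n K)).toSubmodule)

/-- **Gram–Schmidt on `𝔭₀`**: `B|𝔭₀` is positive definite, so `𝔭₀` has a `B`-orthonormal basis.
[cite: Knapp2002, §VI.2] -/
theorem exists_xONB : ∃ b : Module.Basis (Fin (pZeroDim n K)) ℝ (pZero : Submodule ℝ (𝔤 n K)),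
    ∀ i j, trForm n K (b i) (b j) = if i = j then 1 else 0 := by
  letI core : InnerProductSpace.Core ℝ (pZero : Submodule ℝ (𝔤 n K)) :=
    { inner := fun P Q => trForm n K P Q
      conj_inner_symm := fun P Q => by rw [RCLike.conj_to_real]; exact trForm_comm _ _
      re_inner_nonneg := fun P => by rw [RCLike.re_to_real]; exact trForm_self_nonneg_of_herm P.2.1
      add_left := fun P P' Q => by rw [Submodule.coe_add, map_add, LinearMap.add_apply]
      smul_left := fun P Q r => by rw [Submodule.coe_smul, map_smul, LinearMap.smul_apply, smul_eq_mul, RCLike.conj_to_real]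
      definite := fun P hP => Subtype.ext (eq_zero_of_herm_of_trForm_self P.2.1 hP) }
  letI : NormedAddCommGroup (pZero : Submodule ℝ (𝔤 n K)) := InnerProductSpace.Core.toNormedAddCommGroup (𝕜 := ℝ)
  letI : InnerProductSpace ℝ (pZero : Submodule ℝ (𝔤 n K)) := InnerProductSpace.ofCore core.toCore
  exact ⟨(stdOrthonormalBasis ℝ (pZero : Submodule ℝ (𝔤 n K))).toBasis, fun i j =>
    orthonormal_iff_ite.1 (stdOrthonormalBasis ℝ (pZero : Submodule ℝ (𝔤 n K))).orthonormal i j⟩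

/-- A `B`-orthonormal basis of `𝔭₀`. [cite: Knapp2002, §VI.2] -/
def xONB : Module.Basis (Fin (pZeroDim n K)) ℝ (pZero : Submodule ℝ (𝔤 n K)) :=
  Classical.choose (exists_xONB n K)

/-- Orthonormality of `xONB`. [folklore] -/
theorem trForm_xONB (i j : Fin (pZeroDim n K)) :
    trForm n K (xONB n K i) (xONB n K j) = if i = j then 1 else 0 :=
  Classical.choose_spec (exists_xONB n K) i j

/-- **The family `x`** of Kuga's lemma: the orthonormal basis of `𝔭₀`, in `𝔤`. [cite: BorelWallach2000, II §2.5] -/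
def x (i : Fin (pZeroDim n K)) : 𝔤 n K := (xONB n K i : (pZero : Submodule ℝ (𝔤 n K)))

/-- `x i ∈ 𝔭₀`. [folklore] -/
theorem x_mem (i : Fin (pZeroDim n K)) : x n K i ∈ (pZero : Submodule ℝ (𝔤 n K)) := (xONB n K i).2

/-- `B(x i, x j) = δ_{ij}`. [folklore] -/
theorem trForm_x_x (i j : Fin (pZeroDim n K)) : trForm n K (x n K i) (x n K j) = if i = j then 1 else 0 :=
  trForm_xONB n K i j

/-- Expansion of an element of `𝔭₀` in the orthonormal basis, read in `𝔤`. [folklore] -/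
theorem sum_repr_x (P : 𝔤 n K) (hP : P ∈ (pZero : Submodule ℝ (𝔤 n K))) :
    ∑ i, (xONB n K).repr ⟨P, hP⟩ i • x n K i = P := by
  have h := congrArg Subtype.val ((xONB n K).sum_repr ⟨P, hP⟩)
  rw [Submodule.coe_sum] at h
  simpa only [Submodule.coe_smul, x] using h

/-- A basis of `K'`. [folklore] -/
def kBasis : Module.Basis (Fin (kDim n K)) ℝ ((kPrime : LieSubalgebra ℝ (𝔤 n K)).toSubmodule) :=
  Module.finBasis ℝ _

/-- **The adapted basis of `𝔤 = 𝔭₀ ⊕ K'`**, indexed by `ι ⊕ κ`: `xONB` on `inl`, `kBasis` on `inr`.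
[cite: BorelWallach2000, II §2.5] -/
def adaptedBasis : Module.Basis (Fin (pZeroDim n K) ⊕ Fin (kDim n K)) ℝ (𝔤 n K) :=
  ((xONB n K).prod (kBasis n K)).map
    (Submodule.prodEquivOfIsCompl _ _ (isCompl_kPrime_pZero (n := n) (K := K)).symm)

/-- `adaptedBasis (inl i) = x i`. [folklore] -/
theorem adaptedBasis_inl (i : Fin (pZeroDim n K)) : adaptedBasis n K (Sum.inl i) = x n K i := by
  rw [adaptedBasis, Module.Basis.map_apply, Module.Basis.prod_apply, Sum.elim_inl, Function.comp_apply,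
    Submodule.coe_prodEquivOfIsCompl', LinearMap.inl_apply, Submodule.coe_zero, add_zero]
  rfl

/-- `adaptedBasis (inr a) = kBasis a`. [folklore] -/
theorem adaptedBasis_inr (a : Fin (kDim n K)) :
    adaptedBasis n K (Sum.inr a) = (kBasis n K a : ((kPrime : LieSubalgebra ℝ (𝔤 n K)).toSubmodule)) := by
  rw [adaptedBasis, Module.Basis.map_apply, Module.Basis.prod_apply, Sum.elim_inr, Function.comp_apply,
    Submodule.coe_prodEquivOfIsCompl', LinearMap.inr_apply, Submodule.coe_zero, zero_add]

/-- `adaptedBasis (inr a) ∈ K'`. [folklore] -/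
theorem adaptedBasis_inr_mem (a : Fin (kDim n K)) :
    adaptedBasis n K (Sum.inr a) ∈ (kPrime : LieSubalgebra ℝ (𝔤 n K)) := by
  rw [adaptedBasis_inr]
  exact (kBasis n K a).2

/-- **The `B`-dual basis** of the adapted basis. [cite: BorelWallach2000, II §2.5] -/
def dualB : Module.Basis (Fin (pZeroDim n K) ⊕ Fin (kDim n K)) ℝ (𝔤 n K) :=
  (trForm n K).dualBasis trForm_nondegenerate (adaptedBasis n K)

/-- `B(dualB t, adaptedBasis t') = δ`. [folklore] -/
theorem trForm_dualB_adaptedBasis (t t' : Fin (pZeroDim n K) ⊕ Fin (kDim n K)) :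
    trForm n K (dualB n K t) (adaptedBasis n K t') = if t' = t then 1 else 0 :=
  LinearMap.BilinForm.apply_dualBasis_left _ _ t t'

/-- `B(x i, adaptedBasis t') = δ_{t', inl i}` (`x` orthonormal and `B(𝔭₀, K') = 0`). [folklore] -/
theorem trForm_x_adaptedBasis (i : Fin (pZeroDim n K)) (t' : Fin (pZeroDim n K) ⊕ Fin (kDim n K)) :
    trForm n K (x n K i) (adaptedBasis n K t') = if t' = Sum.inl i then 1 else 0 := by
  cases t' with
  | inl j =>
    rw [adaptedBasis_inl, trForm_x_x]
    by_cases h : i = j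
    · subst h
      rw [if_pos rfl, if_pos rfl]
    · rw [if_neg h, if_neg (fun h' => h (Sum.inl_injective h').symm)]
  | inr a =>
    rw [trForm_pZero_kPrime (x_mem n K i) (adaptedBasis_inr_mem n K a), if_neg Sum.inr_ne_inl]

/-- **`dualB (inl i) = x i`**: the dual basis restricted to the `𝔭₀`-indices is `x` itself.
[cite: BorelWallach2000, II §2.5] -/
theorem dualB_inl (i : Fin (pZeroDim n K)) : dualB n K (Sum.inl i) = x n K i := by
  have key : ∀ Y : 𝔤 n K, trForm n K (dualB n K (Sum.inl i) - x n K i) Y = 0 := fun Y => by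
    rw [← (adaptedBasis n K).sum_repr Y, map_sum]
    refine sum_eq_zero fun t _ => ?_
    rw [map_smul, smul_eq_mul, map_sub, LinearMap.sub_apply, trForm_dualB_adaptedBasis, trForm_x_adaptedBasis,
      sub_self, mul_zero]
  exact sub_eq_zero.1 (trForm_nondegenerate.1 _ key)

/-- **`dualB (inr a) ∈ K'`**: the dual basis vectors of the `K'`-indices are `B`-orthogonal to `𝔭₀`,
hence lie in `K'`. [cite: BorelWallach2000, II §2.5] -/
theorem dualB_inr_mem (a : Fin (kDim n K)) : dualB n K (Sum.inr a) ∈ (kPrime : LieSubalgebra ℝ (𝔤 n K)) := by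
  set Y := dualB n K (Sum.inr a) with hY
  have hP : pPart Y ∈ (pZero : Submodule ℝ (𝔤 n K)) := pPart_mem Y
  have hdec : pPart Y = Y - kPart Y := eq_sub_of_add_eq' (kPart_add_pPart Y)
  have h1 : ∀ i, trForm n K (pPart Y) (x n K i) = 0 := fun i => by
    rw [hdec, map_sub, LinearMap.sub_apply, trForm_comm (kPart Y), trForm_pZero_kPrime (x_mem n K i) (kPart_mem Y),
      sub_zero, ← adaptedBasis_inl, hY, trForm_dualB_adaptedBasis, if_neg Sum.inl_ne_inr]
  have h2 : trForm n K (pPart Y) (pPart Y) = 0 := by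
    conv_lhs => arg 2; rw [← sum_repr_x n K (pPart Y) hP]
    rw [map_sum]
    exact sum_eq_zero fun i _ => by rw [map_smul, smul_eq_mul, h1 i, mul_zero]
  have h3 : pPart Y = 0 := eq_zero_of_herm_of_trForm_self hP.1 h2
  have h4 : Y = kPart Y := by
    have h := kPart_add_pPart Y
    rw [h3, add_zero] at h
    exact h.symm
  rw [h4]
  exact kPart_mem Y

/-! ### The hypotheses of Kuga's lemma for `(𝔤, K' = 𝔨 ⊕ ℝ·1)` -/

/-- **The family `w`** (a basis of `K'`) of Kuga's lemma. [cite: BorelWallach2000, II §2.5] -/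
def w (a : Fin (kDim n K)) : 𝔤 n K := adaptedBasis n K (Sum.inr a)

/-- **The family `w'`** (dual to `w`) of Kuga's lemma. [cite: BorelWallach2000, II §2.5] -/
def w' (a : Fin (kDim n K)) : 𝔤 n K := dualB n K (Sum.inr a)

/-- `Sum.elim x w` is the adapted basis. [folklore] -/
theorem sumElim_x_w : Sum.elim (x n K) (w n K) = ⇑(adaptedBasis n K) := by
  funext t
  rcases t with i | a
  · rw [Sum.elim_inl, adaptedBasis_inl]
  · rfl

/-- `Sum.elim x w'` is the dual basis. [folklore] -/
theorem sumElim_x_w' : Sum.elim (x n K) (w' n K) = ⇑(dualB n K) := by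
  funext t
  rcases t with i | a
  · rw [Sum.elim_inl, dualB_inl]
  · rfl

/-- Hypothesis `hw'`: `w' a ∈ K'`. [folklore] -/
theorem kuga_hw' (a : Fin (kDim n K)) : w' n K a ∈ (kPrime : LieSubalgebra ℝ (𝔤 n K)) :=
  dualB_inr_mem n K a

/-- Hypothesis `hxx`: `⁅x i, x j⁆ ∈ K'`. [folklore] -/
theorem kuga_hxx (i j : Fin (pZeroDim n K)) : ⁅x n K i, x n K j⁆ ∈ (kPrime : LieSubalgebra ℝ (𝔤 n K)) :=
  lie_mem_kPrime_of_herm (x_mem n K i).1 (x_mem n K j).1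

/-- Hypothesis `hspan`: `𝔤 = K' + span x`. [folklore] -/
theorem kuga_hspan (z : 𝔤 n K) :
    ∃ k ∈ (kPrime : LieSubalgebra ℝ (𝔤 n K)), ∃ c : Fin (pZeroDim n K) → ℝ, z = k + ∑ i, c i • x n K i :=
  ⟨kPart z, kPart_mem z, fun i => (xONB n K).repr ⟨pPart z, pPart_mem z⟩ i, by
    rw [sum_repr_x n K (pPart z) (pPart_mem z), kPart_add_pPart]⟩

/-- **Hypothesis `hT`**: the tensor `∑_t b_t ⊗ b^t` of the adapted basis and its `B`-dual is
`ad`-invariant (`Literature.Algebra.Lie.sum_lie_basis_tmul_dualBasis_add` for the invariant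
non-degenerate symmetric `B`). [cite: Knapp2002, §V.4] -/
theorem kuga_hT (z : 𝔤 n K) :
    ∑ t, (⁅z, Sum.elim (x n K) (w n K) t⁆ ⊗ₜ[ℝ] Sum.elim (x n K) (w' n K) t +
        Sum.elim (x n K) (w n K) t ⊗ₜ[ℝ] ⁅z, Sum.elim (x n K) (w' n K) t⁆) = (0 : 𝔤 n K ⊗[ℝ] 𝔤 n K) := by
  rw [sumElim_x_w, sumElim_x_w']
  exact Literature.Algebra.Lie.sum_lie_basis_tmul_dualBasis_add trForm_nondegenerate trForm_isSymm
    trForm_lieInvariant (adaptedBasis n K) z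

/-- `B(x i, 1) = 0` and `x i` is Hermitian — so `Tr_{K_∞/ℝ} tr (x i) = 0`: the `x i` have norm
exponent `0` (the hypothesis of `pet_lieDerivW_left`). [folklore] -/
theorem mixedTrace_trace_x (i : Fin (pZeroDim n K)) :
    mixedTrace K ((x n K i : 𝔤 n K) : Matrix (Fin n) (Fin n) (mixedSpace K)).trace = 0 := by
  have h := (x_mem n K i).2
  rw [trForm_apply] at h
  simpa [one] using h

end Bases

end ResGLnCartan

end Literature.NumberTheory.Automorphic

end
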